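import Mathlib
import Summits.Ventures.PercRepro2.Defs
import Summits.Ventures.PercRepro2.Graph
import Summits.Ventures.PercRepro2.Events
import Summits.Ventures.PercRepro2.Harris
import Summits.Ventures.PercRepro2.XWForm
import Summits.Ventures.PercRepro2.XWEmbed
import Summits.Ventures.PercRepro2.XWKFiveTab
import Summits.Ventures.PercRepro2.XWKFive

/-!
# (XW) on every simple graph with at most five vertices (PercRepro2, p2 g24)

**`xw_of_card_le_five`**: for every loop-free graph without parallel edges on a vertex type with
at most five elements, every admissible weight vector and every placement of four distinct
marks, `0 ≤ xwBil ends s y o u p p`.  The graph embeds into `K₅` (`Function.Embedding`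
`V ↪ Fin 5`, the edge map `e ↦ idxOf (Sym2.map φ (ends e))`), the form is carried along by
`XWEmbed.xwBil_embed` with the weights extended by `0`, and `XWKFive.xw_k5` decides.  With
`XWCoincideAll` (coincident marks) this is (XW) on every simple graph with `≤ 5` vertices at
every placement; parallel classes reduce to single edges of weight `1 − ∏(1 − pᵢ)` (paper).
Own work; standard axioms.
-/

namespace Summit.Ventures.PercRepro2

namespace XWFiveVertices

open XWKFive

/-- `edgeIdx` is symmetric. -/
lemma edgeIdx_symm : ∀ a b : Fin 5, edgeIdx a b = edgeIdx b a := by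
  decide

/-- The index in `k5` of a pair of vertices of `Fin 5`. -/
noncomputable def idxOf (z : Sym2 (Fin 5)) : Fin 10 :=
  ⟨Sym2.lift ⟨fun a b => edgeIdx a b, edgeIdx_symm⟩ z % 10, Nat.mod_lt _ (by norm_num)⟩

/-- `k5` at the index of a non-diagonal pair is the pair. -/
lemma k5_idxOf : ∀ z : Sym2 (Fin 5), ¬ z.IsDiag → k5 (idxOf z) = z := by
  intro z
  induction z using Sym2.ind with
  | _ a b =>
    intro hd
    rw [Sym2.mk_isDiag_iff] at hd
    fin_cases a <;> fin_cases b <;> first | exact absurd rfl hd | decide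

section Main

variable {V : Type*} [Fintype V] {E : Type*} [Fintype E] [DecidableEq E]
  {R : Type*} [CommRing R] [LinearOrder R] [IsStrictOrderedRing R]

/-- **(XW) on every simple graph with at most five vertices**, every admissible weight vector,
every placement of four distinct marks. -/
theorem xw_of_card_le_five (hV : Fintype.card V ≤ 5) (ends : E → Sym2 V)
    (hloop : ∀ e, ¬ (ends e).IsDiag) (hinj : Function.Injective ends) (p : E → R)
    (hp : IsProbVec p) (s y o u : V) (hsy : s ≠ y) (hso : s ≠ o) (hsu : s ≠ u) (hyo : y ≠ o)
    (hyu : y ≠ u) (hou : o ≠ u) : 0 ≤ xwBil ends s y o u p p := by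
  obtain ⟨φ⟩ := Function.Embedding.nonempty_of_card_le
    (show Fintype.card V ≤ Fintype.card (Fin 5) by simpa using hV)
  let σ : E → Fin 10 := fun e => idxOf (Sym2.map φ (ends e))
  have hcomp : ∀ e, k5 (σ e) = Sym2.map φ (ends e) := fun e =>
    k5_idxOf _ (fun h => hloop e ((Sym2.isDiag_map φ.injective).1 h))
  have hσ : Function.Injective σ := by
    intro e e' h
    apply hinj
    apply Sym2.map.injective φ.injective
    rw [← hcomp e, ← hcomp e']
    exact congrArg k5 h
  rw [XWEmbed.xwBil_embed hσ φ.injective hcomp p s y o u]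
  exact xw_k5 _ (XWEmbed.isProbVec_extW hσ hp) _ _ _ _ (φ.injective.ne hsy) (φ.injective.ne hso)
    (φ.injective.ne hsu) (φ.injective.ne hyo) (φ.injective.ne hyu) (φ.injective.ne hou)

end Main

end XWFiveVertices

end Summit.Ventures.PercRepro2
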